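import Mathlib
import Summits.NavierStokesRegularity.FluidComputer.ArnoldBeltramiFormTorus
import HarnessLib

/-!
# Saturated states of the forced Beltrami problem are curl-Arnold-null (memo §K.5)

HONEST FRAMING (cell `ns-blowup`, seat `ns-blowup-circuit` g2, human ruling D-0035): nothing here is a
claim about Navier–Stokes regularity or blow-up. WHAT THIS IS NOT: not a statement about unforced NS; it
is the exact corollary of the forced viscous Arnold balance
(`ArnoldBeltramiFormTorus.hasDerivWithinAt_arnoldForm_of_forced_beltrami`) used by memo
`run/shared/lean/pub/ns-blowup/CIRCUIT-OBSTRUCTIONS.md` §K.5 for the cell's nonlinear «rope persistence»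
lanes: along classical NS on `[a, b] × T³` with the host-maintaining force `f = νλ²U` (`curlₑ U = λU`),
`d/dt [Hₑ(u) − λ∫‖u‖²] = −2ν [∫∑ᵢ ωᵢ(curlₑ ω)ᵢ − λ ∫∑ᵢ ωᵢ²]`; hence if the solution is STEADY
(`u t = u a` on `[a, b]`, `a < b`) and `ν ≠ 0`, the curl-weighted Arnold form of the state vanishes:
`∫∑ᵢ ωᵢ(curlₑ ω)ᵢ = λ ∫∑ᵢ ωᵢ²` — a signed integral identity every saturated state must satisfy
(`curl_arnoldForm_eq_zero_of_steady`). By `arnoldForm_sub_beltrami` applied to `ω − λU` this is the same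
as `Q_λ(curlₑ(u − U)) = 0` for the perturbation; that rewriting is not repeated here.
-/

noncomputable section

open Set MeasureTheory Finset
open scoped InnerProductSpace RealInnerProductSpace

namespace Summit.NavierStokesRegularity.FluidComputer.ArnoldBeltramiSaturation

open Literature.Analysis.FunctionSpaces Literature.Analysis.FluidPDE
open Summit.NavierStokesRegularity.FluidComputer.ArnoldBeltramiFormTorus

variable {d : Type*} [Fintype d] [DecidableEq d]

/-- **A steady state of the forced Beltrami problem is curl-Arnold-null.** If `u` is a classical
Navier–Stokes solution on `[a, b] × T^d` (`card d = 3`, `a < b`) with viscosity `ν ≠ 0` and force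
`νλ²U`, `U` a smooth Beltrami host (`curlₑ U = λU`), and `u` does not depend on time, then
`∫ ∑ᵢ ωᵢ (curlₑ ω)ᵢ − λ ∫ ∑ᵢ ωᵢ² = 0` for `ω = curlₑ u(a)` (written exactly as in
`hasDerivWithinAt_arnoldForm_of_forced_beltrami`). [folklore] -/
theorem curl_arnoldForm_eq_zero_of_steady (e : d ≃ Fin 3) {a b ν lam : ℝ} (hab : a < b) (hν : ν ≠ 0)
    {u : ℝ → UnitAddTorus d → EuclideanSpace ℝ d} {p : ℝ → UnitAddTorus d → ℝ}
    {U : UnitAddTorus d → EuclideanSpace ℝ d} (hU : Torus.IsSmooth U)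
    (hcurl : ∀ i x, torusVorticityTensor U (e.symm (e i + 1)) (e.symm (e i + 2)) x = lam * U x i)
    (h : Torus.IsClassicalNSSolutionOn (Icc a b) ν (fun _ x => (ν * lam ^ 2) • U x) u p)
    (hsteady : ∀ t ∈ Icc a b, u t = u a) :
    (∫ x, ∑ i, torusVorticityTensor (u a) (e.symm (e i + 1)) (e.symm (e i + 2)) x *
          (Torus.partialDeriv (e.symm (e i + 1)) (torusVorticityTensor (u a)
              (e.symm (e (e.symm (e i + 2)) + 1)) (e.symm (e (e.symm (e i + 2)) + 2))) x -
            Torus.partialDeriv (e.symm (e i + 2)) (torusVorticityTensor (u a)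
              (e.symm (e (e.symm (e i + 1)) + 1)) (e.symm (e (e.symm (e i + 1)) + 2))) x)) -
        lam * ∫ x, ∑ i, torusVorticityTensor (u a) (e.symm (e i + 1)) (e.symm (e i + 2)) x ^ 2 = 0 := by
  have ha : a ∈ Icc a b := ⟨le_rfl, hab.le⟩
  have hD := hasDerivWithinAt_arnoldForm_of_forced_beltrami e hab hU hcurl h ha
  -- the functional is constant on `[a, b]` because `u` is
  set F : ℝ → ℝ := fun s =>
    (∫ x, ∑ i, u s x i * torusVorticityTensor (u s) (e.symm (e i + 1)) (e.symm (e i + 2)) x) -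
      lam * ∫ x, ‖u s x‖ ^ 2 with hF
  have hconst : HasDerivWithinAt F 0 (Icc a b) a := by
    refine (hasDerivWithinAt_const a (Icc a b) (F a)).congr_of_mem (fun s hs => ?_) ha
    simp only [hF, hsteady s hs]
  have huniq : UniqueDiffWithinAt ℝ (Icc a b) a := (uniqueDiffOn_Icc hab) a ha
  have h0 := hD.derivWithin huniq
  rw [hconst.derivWithin huniq] at h0
  -- `0 = -(2ν) * X` with `ν ≠ 0` gives `X = 0`
  have h2 : -(2 * ν) ≠ 0 := neg_ne_zero.mpr (mul_ne_zero two_ne_zero hν)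
  exact (mul_eq_zero.mp h0.symm).resolve_left h2

end Summit.NavierStokesRegularity.FluidComputer.ArnoldBeltramiSaturation

end
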